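/-
Copyright (c) 2026. All rights reserved.
Released under Apache 2.0 license as described in the file LICENSE.
Authors: abc-iut cell, seat abc-iut-f-072 (gen 4; D-0079 L-F [AbsTop*] — non-vacuity of the typed
hypothesis «once-punctured elliptic curve» at the standard model).
-/
import Literature.AnabelianGeometry.AbsoluteAnabelian.ArchimedeanHolFieldFunctorGeometricOverIdRigidTorus
import Literature.AnabelianGeometry.AbsoluteAnabelian.ArchimedeanReconstruction
import Literature.AnabelianGeometry.AbsoluteAnabelian.HolomorphicEllipticCuspidalizationGenusOneHolds
import Literature.AnabelianGeometry.AbsoluteAnabelian.HolomorphicEllipticCuspidalizationGenuineGroupLawUnique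
import Literature.AnabelianGeometry.AbsoluteAnabelian.PuncturedEllipticCurveUniversalCoverHolds
import HarnessLib

/-!
# The punctured complex torus `ℂ/Φ(ℤ²) ∖ {x₀}` IS a once-punctured elliptic curve in the typed sense
# (`TorsionPointsDenseUniqueGroupLaw.IsPuncturedEllipticCurve`) — non-vacuity, at the standard model, of
# the typed hypothesis describing the `𝔼` of [AbsTopIII] Cor 2.7 (a)

S. Mochizuki, *Topics in Absolute Anabelian Geometry III*, Cor. 2.7 p. 58.  Print's hypothesis
(p. 58): "Let `𝕏` be an elliptically admissible Aut-holomorphic orbispace [cf. Remark 2.1.1] associated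
to a Riemann orbisurface `X`."; the once-punctured elliptic curve is the object `𝔼` CONSTRUCTED in step
(a) (p. 58 last line – p. 59 l. 2): "[Thus, `𝔼` is the Aut-holomorphic space associated to a
once-punctured elliptic curve.]" — it is this `𝔼` (the double covering `𝔼 → ℍ` of the semi-elliptic
hyperbolic core, (a)) that the typed predicate below describes; the words "over `ℂ`" are not at this
locus (the complex-archimedean setting is that of [IUTchI] Def. 3.1 (b)).  (v2, doc-only: header quote
re-sourced verbatim per referee defect K28-n4; v1 carried a composed quotation; declarations unchanged.)
The abc-iut cell types "once-punctured elliptic curve" CONFORMALLY (abc-iut-L4-t14,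
`ArchimedeanReconstruction.lean`, audit A21-F7): `IsPuncturedEllipticCurve E` := `E` is biholomorphic
to the complement of a point `t₀` in a compact connected Riemann surface `T` homeomorphic to a torus.
Dozens of kernel theorems of the tree
take `(hE : IsPuncturedEllipticCurve E)` as their hypothesis (Cor 2.7 (c) density / unique group law,
hyperbolic cores, universal covers, the genuine Cor 4.5 instances of abc-iut-L4-t10, …), and the tree
proves the CONVERSE direction (every such `E` is biholomorphic to some punctured complex torus,
`HolomorphicEllipticCuspidalization.puncturedEllipticCurveModel_holds`), but — until this file — no
kernel theorem PRODUCED the hypothesis at a concrete carrier.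

PROOF-ONLY companion (no definitions).  Contents:

* `isPuncturedEllipticCurve_compl_singleton_complexTorus` — for every lattice `Φ : ℝ² ≃ ℂ` and every
  point `x₀` of the complex torus `T = ℂ/Φ(ℤ²)` (`Literature.Geometry.Kaehler.ComplexTorus Φ`), the open
  submanifold `T ∖ {x₀}` satisfies `IsPuncturedEllipticCurve`: take `T` itself (compact, connected,
  Hausdorff, a complex manifold), `t₀ := x₀`, `e :=` the identity, the homeomorphism
  `T ≃ₜ (Fin 2 → ℝ/ℤ) ≃ₜ ℝ/ℤ × ℝ/ℤ`, and the two inclusions are holomorphic (`contMDiff_subtype_val`,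
  resp. the identity of the open submanifold);
* `HolRS.isPuncturedEllipticCurve_puncturedTorus` — the same for the carrier of the `HolRS` object
  `HolRS.puncturedTorus Φ x₀` of abc-iut-w5-d144 / abc-iut-L4-t10 (definitionally that open submanifold),
  so that e.g. abc-iut-L4-t10's `HolRS.cor_4_5_geometric_mapsTo_of_isPuncturedEllipticCurve` (p450973)
  fires at a concrete `𝕏` with no hypothesis left;
* three NON-VACUITY certificates, i.e. existing conditional theorems of the tree fired at the model with
  NO hypothesis: `dense_cuspidalTorsionPoints_compl_singleton_complexTorus` (Cor 2.7 (c), density of the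
  cuspidal torsion points — abc-iut-L4-t12/L4-t8 lineage `dense_cuspidalTorsionPoints_of_isPuncturedEllipticCurve`),
  `existsUnique_groupLaw_compl_singleton_complexTorus` (Cor 2.7 (c), the unique group law on the
  one-point compactification — `existsUnique_groupLaw_of_isPuncturedEllipticCurve`), and
  `exists_disc_covering_compl_singleton_complexTorus` (Def 2.1 (i) / Cor 2.4: a holomorphic covering by
  the unit disc — `exists_disc_covering_of_isPuncturedEllipticCurve'`).

HONEST FRAMING: classical; a statement about OUR model `ComplexTorus Φ` and OUR typed predicate;
nothing here bears on [IUTchIII] Cor. 3.12; typed ≠ proved elsewhere.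
-/

noncomputable section

open scoped Manifold ContDiff Topology
open TopologicalSpace

namespace Literature.AnabelianGeometry.AbsoluteAnabelian

open Literature.Geometry.Kaehler

variable (Φ : (Fin 2 → ℝ) ≃L[ℝ] ℂ) (x₀ : ComplexTorus Φ)

/-- **The punctured complex torus is a once-punctured elliptic curve in the typed (conformal) sense.**
For `T := ComplexTorus Φ = ℂ/Φ(ℤ²)` and `x₀ ∈ T`, the open submanifold `T ∖ {x₀}` is biholomorphic (by the
identity) to the complement of the point `x₀` in the compact connected Riemann surface `T`, which is
homeomorphic to the torus `ℝ/ℤ × ℝ/ℤ`. [cite: MochizukiAbsTopIII2015, Corollary 2.7 (a) p.58] -/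
theorem isPuncturedEllipticCurve_compl_singleton_complexTorus :
    TorsionPointsDenseUniqueGroupLaw.IsPuncturedEllipticCurve
      ↥((⟨{x₀}ᶜ, isOpen_compl_singleton⟩ : Opens (ComplexTorus Φ))) := by
  -- the identity of `T ∖ {x₀}`, read between the `Opens`-subtype and the `Set`-subtype
  let e : ↥((⟨{x₀}ᶜ, isOpen_compl_singleton⟩ : Opens (ComplexTorus Φ))) ≃ₜ
      ↥(({x₀}ᶜ : Set (ComplexTorus Φ))) :=
    { toFun := fun x => ⟨x.1, x.2⟩
      invFun := fun x => ⟨x.1, x.2⟩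
      left_inv := fun _ => rfl
      right_inv := fun _ => rfl
      continuous_toFun := continuous_subtype_val.subtype_mk _
      continuous_invFun := continuous_subtype_val.subtype_mk _ }
  refine ⟨ComplexTorus Φ, inferInstance, inferInstance, inferInstance, inferInstance, inferInstance,
    inferInstance, x₀, e,
    ⟨(ComplexTorus.toRealTorus Φ).trans (Homeomorph.piFinTwo fun _ : Fin 2 => AddCircle (1 : ℝ))⟩,
    ?_, ?_⟩
  · -- the inclusion `T ∖ {x₀} → T` is holomorphic (an open submanifold)
    exact (contMDiff_subtype_val (I := 𝓘(ℂ, ℂ)) (n := ω)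
      (U := (⟨{x₀}ᶜ, isOpen_compl_singleton⟩ : Opens (ComplexTorus Φ)))).mdifferentiable (by simp)
  · -- `e.symm` composed with the tautological map is the identity of the open submanifold
    have h : (fun t : (⟨{x₀}ᶜ, isOpen_compl_singleton⟩ : Opens (ComplexTorus Φ)) =>
        e.symm ⟨t.1, t.2⟩) = id := by
      funext t; rfl
    rw [h]
    exact mdifferentiable_id

/-- **`HolRS.puncturedTorus Φ x₀` is a once-punctured elliptic curve in the typed sense**: the carrier of
the `HolRS` object `ℂ/Φ(ℤ²) ∖ {x₀}` (abc-iut-w5-d144) satisfies `IsPuncturedEllipticCurve`, so every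
kernel theorem of the tree hypothesised on `IsPuncturedEllipticCurve 𝕏.carrier` (e.g.
`HolRS.cor_4_5_geometric_mapsTo_of_isPuncturedEllipticCurve`, `HolRS.isIdRigid_mapsTo_of_isPuncturedEllipticCurve`)
fires at this concrete `𝕏`. [cite: MochizukiAbsTopIII2015, Corollary 2.7 (a) p.58] -/
theorem HolRS.isPuncturedEllipticCurve_puncturedTorus :
    TorsionPointsDenseUniqueGroupLaw.IsPuncturedEllipticCurve (HolRS.puncturedTorus Φ x₀).carrier :=
  isPuncturedEllipticCurve_compl_singleton_complexTorus Φ x₀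

/-! ### Non-vacuity certificates: conditional theorems of the tree fired at the model -/

/-- **[AbsTopIII] Cor 2.7 (c), density clause, AT THE MODEL with no hypothesis**: the cuspidal torsion
points of the punctured complex torus `ℂ/Φ(ℤ²) ∖ {x₀}` are dense.
[cite: MochizukiAbsTopIII2015, Corollary 2.7 (c) p.59] -/
theorem dense_cuspidalTorsionPoints_compl_singleton_complexTorus :
    Dense (cuspidalTorsionPoints ↥((⟨{x₀}ᶜ, isOpen_compl_singleton⟩ : Opens (ComplexTorus Φ)))) :=
  HolomorphicEllipticCuspidalization.dense_cuspidalTorsionPoints_of_isPuncturedEllipticCurve _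
    (isPuncturedEllipticCurve_compl_singleton_complexTorus Φ x₀)

/-- **[AbsTopIII] Cor 2.7 (c), group-law clause, AT THE MODEL with no hypothesis**: the one-point
compactification of `ℂ/Φ(ℤ²) ∖ {x₀}` carries a UNIQUE commutative topological group law with `∞ = 0`
along which it is (holomorphically on the punctured torus) a complex torus of the tree.
[cite: MochizukiAbsTopIII2015, Corollary 2.7 (c) p.59] -/
theorem existsUnique_groupLaw_compl_singleton_complexTorus :
    ∃! g : AddCommGroup (OnePoint ↥((⟨{x₀}ᶜ, isOpen_compl_singleton⟩ : Opens (ComplexTorus Φ)))),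
      letI : AddCommGroup (OnePoint ↥((⟨{x₀}ᶜ, isOpen_compl_singleton⟩ : Opens (ComplexTorus Φ)))) := g
      IsTopologicalAddGroup (OnePoint ↥((⟨{x₀}ᶜ, isOpen_compl_singleton⟩ : Opens (ComplexTorus Φ)))) ∧
        (OnePoint.infty : OnePoint ↥((⟨{x₀}ᶜ, isOpen_compl_singleton⟩ : Opens (ComplexTorus Φ)))) = 0 ∧
        ∃ (Ψ : (Fin 2 → ℝ) ≃L[ℝ] ℂ)
          (ψ : OnePoint ↥((⟨{x₀}ᶜ, isOpen_compl_singleton⟩ : Opens (ComplexTorus Φ))) ≃ₜ+ ComplexTorus Ψ),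
          MDifferentiable 𝓘(ℂ, ℂ) 𝓘(ℂ, ℂ)
            (fun x : ↥((⟨{x₀}ᶜ, isOpen_compl_singleton⟩ : Opens (ComplexTorus Φ))) => ψ x) :=
  HolomorphicEllipticCuspidalization.existsUnique_groupLaw_of_isPuncturedEllipticCurve
    (isPuncturedEllipticCurve_compl_singleton_complexTorus Φ x₀)

/-- **[AbsTopIII] Def 2.1 (i) / Cor 2.4 (b) AT THE MODEL with no hypothesis**: the punctured complex torus
`ℂ/Φ(ℤ²) ∖ {x₀}` is holomorphically covered by the open unit disc.
[cite: MochizukiAbsTopIII2015, Definition 2.1 (i) p.50] -/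
theorem exists_disc_covering_compl_singleton_complexTorus :
    ∃ p : unitDiscOpens → ↥((⟨{x₀}ᶜ, isOpen_compl_singleton⟩ : Opens (ComplexTorus Φ))),
      IsCoveringMap p ∧ Function.Surjective p ∧ MDifferentiable 𝓘(ℂ, ℂ) 𝓘(ℂ, ℂ) p :=
  HolomorphicEllipticCuspidalization.exists_disc_covering_of_isPuncturedEllipticCurve' _
    (isPuncturedEllipticCurve_compl_singleton_complexTorus Φ x₀)

end Literature.AnabelianGeometry.AbsoluteAnabelian

end
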